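import Literature.AlgebraicGeometry.HodgeTheory.SemiregularityWeakCriterion
import Literature.AlgebraicGeometry.Markman2025.ContractionExpConjugation

/-!
# Markman 2025 — LEMMA 9.3.11 «The twisted reflexive sheaf `B` is semiregular» and REMARK 9.3.10: the two
# diagram chases on (9.3.5), and the algebra of p. 88 L3–9 (the leftmost square), AS PRINTED, kernel-checked

E. Markman: [M] *Cycles on abelian 2n-folds of Weil type from secant sheaves on abelian n-folds*,
arXiv:2502.03415 **v2** (2025-06-08), bib `Markman2025SecantWeil` — UNREFEREED PREPRINT. «p. N L m» = PyMuPDF line `m`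
of page `N` of the public v2 PDF (sha256/16 `8155aa33870069b8`); diagram (9.3.5) and p. 88 L1–27 were read BY EYE at
seat lit-w-markman g20 (pub-hsemireg LIT-W, 2026-08-24; renders `r_mar25v2_p87_diagram935.png`, `r_mar25v2_p88_top.png`
in `HOME/lit/Markman-renders-litw-markman-g20/`; sheet `LOCATOR-SHEET-MARKMAN.md` §2 (statements of §9.3 verbatim) and
§64 (this file)). This is the bookkeeping behind row M-Mk6 of the LIT-W table («the one printed `g = 6` semiregular
object»): `E` is the reflexive secant^{⊠2}-sheaf of rank `r = 8d` over `M := X × X̂` (Prop. 9.2.2), `G^∨`-linearized,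
`Y := M/Ḡ`, `q : M → Y` the quotient map, `B` the `μ_r`-twisted reflexive sheaf over `Y` of Lemma 9.3.6 with
`ℙ(ι^*B)` the descended projective bundle, `λ := c₁(E)/r`, `κ(E) = ch(E)exp(−λ)`.

## What is printed (verbatim, v2)

* p. 81 L66 – p. 82 L7 (the equivariance paragraph): «Set `E′ := I_{∪Σ_i} ⊠ I_{∪C_i}`. The image of the obstruction map
  `ob_{E′} : HT²(X × X) → Ext²(E′, E′)` is `Ext²(E′, E′)^{G₁×G₂}`. The inclusion `Im(ob_{E′}) ⊂ Ext²(E′, E′)^{G₁×G₂}`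
  follows from the `G_i`-equivariance of `ob_{I_{∪C_i}}` and `ob_{I_{∪Σ_i}}` and the fact that both groups act trivially on
  `HT²(X × X)`. The inclusion `Ext²(E′, E′)^{G₁×G₂} ⊂ Im(ob_{E′})` follows from the surjectivity of
  `HT^j(X) → Ext^j(I_{∪C_i}, I_{∪C_i})^{G₁}`, for `j ≤ 2`, and the analogous surjectivity for `I_{∪Σ_i}`, which in turn
  follows from Lemmas 8.3.7 and 8.3.8.»
* LEMMA 9.3.2 (p. 82 L24–25): «The image of the obstruction homomorphism `ob_G : HH²(X × X) → Hom(G, G[2])` is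
  `Hom(G, G[2])^G := Hom((G, λ), (G, λ)[2])`.» (for `E`: p. 87 L92 «The image of `ob_E` in `Ext²(E, E)` is
  `Ext²(E, E)^{G^∨}`, by Lemma 9.3.2.»)
* p. 82 L31–34: «The semi-regularity map `σ : Hom(G, G[2]) → ⊕_{q=0}^{4} H^{q+2}(Ω^q_{X×X̂})` restricts to an injective
  homomorphism from `Hom(G, G[2])^G`, by Remark 8.3.5, Lemma 8.4.1, and Remark 9.2.3. In that sense `(G, λ)` is
  semi-regular.» — REMARK 8.3.5 (p. 59 L37–39): «If we drop the assumption that `ob_E` is surjective in Lemma 8.3.4 we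
  still conclude that the semiregularity map restricts to the image of the obstruction map as an injective map.»;
  LEMMA 8.4.1 (2) (p. 64 L33–35): «The kernel of `ob_E` is equal to the subspace of `HT²(X × X̂)` annihilating `ch(E)`.»;
  REMARK 9.2.3 (p. 73 L31–33): «… All the results of section 8 for `E` holds for `G` as well, by Remark 8.5.4.» [sic]
* LEMMA 9.3.9 (p. 87 L22): «The following diagram is commutative. (9.3.5)» — the diagram, by eye (nine nodes, fifteen
  arrows): top row `HT²(M) —ob_E := exp(at_E)→ Ext²(E,E)^{G^∨}`; second row `H¹(TM) —at_E − λ·id_E→ Ext²₀(E,E)^{G^∨}`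
  with `⌟exp(−λ)` (9.3.4) `: H¹(TM) → HT²(M)` and `⊂ : Ext²₀(E,E)^{G^∨} → Ext²(E,E)^{G^∨}`; third row
  `H¹(TY) —at_B→ H²(Y, 𝒜₀)` with `q^* : H¹(TY) → H¹(TM)` and `q^* : H²(Y, 𝒜₀) → Ext²₀(E,E)^{G^∨}`; then
  `⌟κ(B) : H¹(TY) → ∏_{q=1}^4 H^{q+2}(Ω^q_Y)`, `σ_B : H²(Y, 𝒜₀) → ∏_{q=1}^4 H^{q+2}(Ω^q_Y)`,
  `q^* : ∏_{q=1}^4 H^{q+2}(Ω^q_Y) → ∏_{q=1}^4 H^{q+2}(Ω^q_M)`, `⌟κ(E) : H¹(TM) → ∏_{q=1}^4 H^{q+2}(Ω^q_M)`,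
  `q^*σ_B : Ext²₀(E,E)^{G^∨} → ∏_{q=1}^4 H^{q+2}(Ω^q_M)`, the bottom vertical arrow
  `∪exp(λ) : ∏_{q=1}^4 H^{q+2}(Ω^q_M) → ∏_{q=0}^4 H^{q+2}(Ω^q_M)`, and the outer arrows
  `⌟ch(E) : HT²(M) → ∏_{q=0}^4 H^{q+2}(Ω^q_M)`, `σ_E : Ext²(E,E)^{G^∨} → ∏_{q=0}^4 H^{q+2}(Ω^q_M)`. Its faces, named as in
  the printed proof (p. 87 L92 – p. 88 L12): the OUTER TRIANGLE (`σ_E ∘ ob_E = ⌟ch(E)`, «follows from the commutativity of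
  diagram (8.3.4)»), the UPPER TRAPEZOID (`ob_E ∘ ⌟exp(−λ) = ⊂ ∘ (at_E − λ·id_E)`), the LEFTMOST SQUARE
  (`⌟ch(E) ∘ ⌟exp(−λ) = ∪exp(λ) ∘ ⌟κ(E)`), the RIGHTMOST SQUARE (`σ_E ∘ ⊂ = ∪exp(λ) ∘ q^*σ_B`, «follows from Equation
  (9.3.3)»), and «the three inner squares» (`(at_E − λ·id_E) ∘ q^* = q^* ∘ at_B`, `⌟κ(E) ∘ q^* = q^* ∘ ⌟κ(B)`,
  `q^*σ_B ∘ q^* = q^* ∘ σ_B`); the INTERMEDIATE TRIANGLE is `q^*σ_B ∘ (at_E − λ·id_E) = ⌟κ(E)` and the INNER TRIANGLE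
  is `σ_B ∘ at_B = ⌟κ(B)` (= diagram (7.2.2) for `B`).
* p. 87 L100 – p. 88 L9 (inside the proof of Lemma 9.3.9): «The cohomological action of `L ⊗ (•)` on `H^*(M, ℂ)` is
  multiplication by `exp(λ)`. When `λ = c₁(L)`, for some line bundle `L`, and `ζ ∈ HT²(M)` Lemma 9.3.8 and the equality
  `ch(E) = exp(λ) ∪ κ(E)` yield the equality `exp(−λ) ∪ (ζ⌟ch(E)) = (ζ⌟exp(λ))⌟κ(E)`. Substitute `ζ⌟exp(−λ)` for `ζ`
  above and multiply on the left by `exp(λ)` to get the equivalent equality `(ζ⌟exp(−λ))⌟ch(E) = exp(λ) ∪ (ζ⌟κ(E))`. The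
  commutativity of the leftmost square follows in this case. It follows in general, by the argument used above taking
  the Zariski closure of the `Pic(M)`-orbit.»
* REMARK 9.3.10 (p. 88 L13–18): «Note that Diagram (7.2.2) appears as the inner triangle in the above diagram. Lemma
  9.3.9 provides an alternative proof for the commutativity of Diagram (7.2.2), as it follows from the commutativity of
  the outer triangle and the six squares in Diagram (9.3.5), which implies the commutativity of the intermediate and
  inner triangles (as all arrows labeled `q^*` are isomorphisms and the bottom vertical arrow is injective).»
* LEMMA 9.3.11 (p. 88 L19): «The twisted reflexive sheaf `B` is semiregular.» PROOF (p. 88 L20–27): «The image of `ob_E`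
  in `Ext²(E, E)` is `Ext²(E, E)^{G^∨}`, by Lemma 9.3.2. Consequently, the restriction of `σ_E` to `Ext²(E, E)^{G^∨}` is
  injective, by Remark 8.3.5, Lemma 8.4.1(2), and Remark 9.2.3. The injectivity of the restriction of `q^*σ_B` to
  `Ext²(E, E)^{G^∨}` follows by the commutativity of the rightmost square of diagram (9.3.5). The injectivity of `σ_B`
  follows by the commutativity of the square with edges `σ_B` and `q^*σ_B`, as the arrows labeled `q^*` are all
  isomorphisms. □»

## The model and what is proved (0 `def`, 0 named fact, 0 sorry; nothing geometric)
§A0 (the equivariance paragraph, its FIRST inclusion): an equivariant map from a trivially-acted-on source lands in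
the invariants — `ob(γ·t) = γ·ob(t)` and `γ·t = t` give `γ·ob(t) = ob(t)` (`range_le_invariants`; the reverse
inclusion — surjectivity via Lemmas 8.3.7 ∕ 8.3.8 — and the transport `E′ ↦ G ↦ E` across `Φ̃` are BY VALUE).
§A (sentence 1–2 of the proof of 9.3.11, LINEAR): `ob : T →ₗ X` (`ob_E` on `T = HT²(M)`, `X = Ext²(E,E)`),
`σ : X →ₗ Ω₀` (`σ_E`), `c = σ ∘ ob` (`⌟ch(E)`, diagram (8.3.4)), `ker c ≤ ker ob` (Lemma 8.4.1 (2) with Remark 9.2.3;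
only this inclusion of the printed equality is used), `range ob = V` (Lemma 9.3.2, `V = Ext²(E,E)^{G^∨}`) ⟹ `σ` is
injective on `V` (`sigmaE_injOn_invariants`; the tree's Remark 8.3.5 = `HodgeTheory.injOn_range_iff_weakCriterion`).
§B (REMARK 9.3.10, plain maps between nine types): outer triangle + the six faces + injectivity of `∪exp(λ)` ⟹ the
intermediate triangle; + injectivity of `q^* : ∏H^{q+2}(Ω^q_Y) → ∏H^{q+2}(Ω^q_M)` ⟹ the inner triangle
(`intermediate_triangle`, `inner_triangle`). PRINT-READING PRECISION P-9.3.10 (nothing moves): of «all arrows labeled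
`q^*` are isomorphisms» the chase uses only the injectivity of that one `q^*`.
§C (LEMMA 9.3.11, sentences 3–4, plain maps): `σ_E` injective on `Ext²(E,E)^{G^∨}` + the rightmost square ⟹ `q^*σ_B`
injective (`qSigmaB_injective` — the injectivity of `∪exp(λ)` is not even needed here); + the inner right square and
the injectivity of `q^* : H²(Y, 𝒜₀) → Ext²₀(E,E)^{G^∨}` ⟹ `σ_B` injective (`sigmaB_injective`); assembled with §A in
the linear setting: `lemma9311`. PRINT-READING PRECISION P-9.3.11 (nothing moves): sentence 3 writes
«restriction of `q^*σ_B` to `Ext²(E, E)^{G^∨}`» where the diagram's node is `Ext²₀(E,E)^{G^∨}`.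
§D (p. 88 L3–9, the leftmost square «in this case», in the model of `ContractionExpConjugation.lean`: a commutative
`ℚ`-algebra `A` for the even part of `HΩ^*(M)`, a derivation `D` for `ζ⌟` with `ζ ∈ H¹(TM)`, a nilpotent `l` for `λ`,
`IsNilpotent.exp`): with `ch = exp(l)·κ`, the first display `exp(−l)·D(ch) = D(l)·κ + D(κ)` (`display_one`; the
right side is `(ζ⌟exp(λ))⌟κ(E)` by Lemma 9.3.8 = `ContractionExp.ad_exp_neg_apply`), the second display
`−D(l)·ch + D(ch) = exp(l)·D(κ)` (`display_two`, `(ζ⌟exp(−λ)) = (−ζ⌟λ, ζ, 0)` acting on `ch(E)`), the `H²(𝒪_M)`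
component (`display_two_H2O`: multiplication operators), the injectivity of «the bottom vertical arrow» `∪exp(λ)`
(`mul_exp_injective`), and the matrix law behind «Substitute `ζ⌟exp(−λ)` for `ζ`»: the unipotent matrices of (9.3.4)
satisfy `U(a)U(b) = U(a + b)` and `U(−λ)U(λ) = 1 = U(λ)U(−λ)` (`U_mul`, `U_neg_mul_self`).
BY VALUE (printed inputs, hypotheses here, NOT proved): every node and arrow of (9.3.5) (Atiyah classes, `ob`, `σ`,
`q^*`, (9.3.3), (9.3.4), [CBR]), Lemma 9.3.2, Lemma 8.4.1 (2), Remark 9.2.3, diagram (8.3.4), the commutativity of the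
six faces themselves (Lemma 9.3.9 — only its CONSEQUENCES are chased here), the `H⁰(∧²TM)` column of (9.3.4) (operator
form in the Appendix of `ContractionExpConjugation.lean`), the «Zariski closure of the `Pic(M)`-orbit» density step,
and everything about `E`, `B`, `Y`. Nothing in this file says that any object of the pub-hsemireg cell is semiregular,
that Conjecture 7.3.9 holds beyond the printed cases, or that HC / HC_CM / HC_AV is proved; it re-proves no theorem of
[M] beyond the displayed linear-algebra steps.
-/

namespace Literature.AlgebraicGeometry.Markman2025.Diagram935

/-! ### §A0 — the equivariance paragraph (p. 81 L66 – p. 82 L7): `Im(ob) ⊂` the invariants -/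

section Equivariance

variable {Γ T X : Type*} [SMul Γ T] [SMul Γ X]

/-- «The inclusion `Im(ob_{E′}) ⊂ Ext²(E′, E′)^{G₁×G₂}` follows from the `G_i`-equivariance of `ob_{I_{∪C_i}}` and
`ob_{I_{∪Σ_i}}` and the fact that both groups act trivially on `HT²(X × X)`.» — for any `Γ`-equivariant map
`ob : T → X` from a `Γ`-set with TRIVIAL action, every value is `Γ`-invariant. (The reverse inclusion, via the
surjectivities of Lemmas 8.3.7 ∕ 8.3.8, is BY VALUE.) [cite: Markman2025SecantWeil, §9.3 p. 82 L3–7] -/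
theorem range_le_invariants (ob : T → X) (hequiv : ∀ (γ : Γ) (t : T), ob (γ • t) = γ • ob t)
    (htriv : ∀ (γ : Γ) (t : T), γ • t = t) (γ : Γ) (t : T) : γ • ob t = ob t := by
  rw [← hequiv, htriv]

/-- The same for LEMMA 9.3.2's form «The image of the obstruction homomorphism `ob_G` … is `Hom(G, G[2])^G`», inclusion
`⊂`: every element of the image is fixed by every `γ`. [cite: Markman2025SecantWeil, Lemma 9.3.2, p. 82 L24–27] -/
theorem mem_range_invariant (ob : T → X) (hequiv : ∀ (γ : Γ) (t : T), ob (γ • t) = γ • ob t)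
    (htriv : ∀ (γ : Γ) (t : T), γ • t = t) {x : X} (hx : x ∈ Set.range ob) (γ : Γ) : γ • x = x := by
  obtain ⟨t, rfl⟩ := hx
  exact range_le_invariants ob hequiv htriv γ t

end Equivariance

/-! ### §A — proof of LEMMA 9.3.11, sentences 1–2: `σ_E` is injective on `Ext²(E,E)^{G^∨}` -/

section SentenceOne

variable {K : Type*} [CommRing K] {T X Ω : Type*} [AddCommGroup T] [Module K T] [AddCommGroup X] [Module K X]
  [AddCommGroup Ω] [Module K Ω]

/-- «The image of `ob_E` in `Ext²(E, E)` is `Ext²(E, E)^{G^∨}`, by Lemma 9.3.2. Consequently, the restriction of `σ_E`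
to `Ext²(E, E)^{G^∨}` is injective, by Remark 8.3.5, Lemma 8.4.1(2), and Remark 9.2.3.» — with `σ ∘ ob = c` (diagram
(8.3.4)), `ker c ≤ ker ob` (Lemma 8.4.1 (2) via Remark 9.2.3) and `range ob = V` (Lemma 9.3.2), `σ` is injective on
`V`; the step «by Remark 8.3.5» is the tree's `HodgeTheory.injOn_range_iff_weakCriterion` /
`weakCriterion_iff_ker_contract_le_ker_ev`. [cite: Markman2025SecantWeil, Lemma 9.3.11, proof p. 88 L20–22] -/
theorem sigmaE_injOn_invariants (ob : T →ₗ[K] X) (σ : X →ₗ[K] Ω) (c : T →ₗ[K] Ω) (hcomm : σ ∘ₗ ob = c)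
    (hker : LinearMap.ker c ≤ LinearMap.ker ob) (V : Submodule K X) (hV : LinearMap.range ob = V) :
    Set.InjOn σ (V : Set X) := by
  rw [← hV]
  exact (HodgeTheory.injOn_range_iff_weakCriterion ob σ).mpr
    ((HodgeTheory.weakCriterion_iff_ker_contract_le_ker_ev ob σ c hcomm).mpr hker)

/-- The same, as injectivity of the restricted map `σ_E|_V : Ext²(E,E)^{G^∨} → ∏_{q=0}^4 H^{q+2}(Ω^q_M)` (the arrow
`σ_E` of diagram (9.3.5)). [cite: Markman2025SecantWeil, Lemma 9.3.11, proof p. 88 L20–22] -/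
theorem sigmaE_restrict_injective (ob : T →ₗ[K] X) (σ : X →ₗ[K] Ω) (c : T →ₗ[K] Ω) (hcomm : σ ∘ₗ ob = c)
    (hker : LinearMap.ker c ≤ LinearMap.ker ob) (V : Submodule K X) (hV : LinearMap.range ob = V) :
    Function.Injective (σ.domRestrict V) := by
  intro x y h
  exact Subtype.ext (sigmaE_injOn_invariants ob σ c hcomm hker V hV x.2 y.2 h)

end SentenceOne

/-! ### §B — REMARK 9.3.10: outer triangle + six faces ⟹ intermediate and inner triangles -/

section Chase

/- Nodes of (9.3.5): `HT = HT²(M)`, `TM = H¹(TM)`, `TY = H¹(TY)`, `XG = Ext²(E,E)^{G^∨}`, `X0 = Ext²₀(E,E)^{G^∨}`,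
`A0 = H²(Y, 𝒜₀)`, `ΩY = ∏_{q=1}^4 H^{q+2}(Ω^q_Y)`, `Ω₁ = ∏_{q=1}^4 H^{q+2}(Ω^q_M)`, `Ω₀ = ∏_{q=0}^4 H^{q+2}(Ω^q_M)`.
Arrows: `ob = ob_E`, `e = ⌟exp(−λ)`, `a = at_E − λ·id_E`, `i = ⊂`, `q₁, q₂, q₃` the three `q^*`, `aB = at_B`,
`kB = ⌟κ(B)`, `sB = σ_B`, `kE = ⌟κ(E)`, `t = q^*σ_B`, `u = ∪exp(λ)`, `cE = ⌟ch(E)`, `sE = σ_E`. -/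
variable {HT TM TY XG X0 A0 ΩY Ω₁ Ω₀ : Type*}
  (ob : HT → XG) (e : TM → HT) (a : TM → X0) (i : X0 → XG) (q₁ : TY → TM) (aB : TY → A0) (q₂ : A0 → X0)
  (kB : TY → ΩY) (sB : A0 → ΩY) (q₃ : ΩY → Ω₁) (kE : TM → Ω₁) (t : X0 → Ω₁) (u : Ω₁ → Ω₀) (cE : HT → Ω₀)
  (sE : XG → Ω₀)

/-- REMARK 9.3.10, first half: the OUTER TRIANGLE (`σ_E ∘ ob_E = ⌟ch(E)`), the UPPER TRAPEZOID, the LEFTMOST and the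
RIGHTMOST SQUARES, and the injectivity of «the bottom vertical arrow» `∪exp(λ)` give the INTERMEDIATE TRIANGLE
`q^*σ_B ∘ (at_E − λ·id_E) = ⌟κ(E)`: indeed `∪exp(λ) ∘ q^*σ_B ∘ (at_E − λ·id) = σ_E ∘ ⊂ ∘ (at_E − λ·id) =
σ_E ∘ ob_E ∘ ⌟exp(−λ) = ⌟ch(E) ∘ ⌟exp(−λ) = ∪exp(λ) ∘ ⌟κ(E)`. (The three inner squares are not needed for this half.)
[cite: Markman2025SecantWeil, Remark 9.3.10, p. 88 L13–18] -/
theorem intermediate_triangle (houter : ∀ x, sE (ob x) = cE x) (htrap : ∀ z, ob (e z) = i (a z))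
    (hleft : ∀ z, cE (e z) = u (kE z)) (hright : ∀ x, sE (i x) = u (t x)) (hu : Function.Injective u) :
    ∀ z, t (a z) = kE z := by
  intro z
  apply hu
  rw [← hright, ← htrap, houter, hleft]

/-- REMARK 9.3.10, second half: the INTERMEDIATE TRIANGLE, «the three inner squares» and the injectivity of
`q^* : ∏_{q=1}^4 H^{q+2}(Ω^q_Y) → ∏_{q=1}^4 H^{q+2}(Ω^q_M)` give the INNER TRIANGLE `σ_B ∘ at_B = ⌟κ(B)`, i.e. diagram
(7.2.2) for `B`: `q^* ∘ σ_B ∘ at_B = q^*σ_B ∘ q^* ∘ at_B = q^*σ_B ∘ (at_E − λ·id) ∘ q^* = ⌟κ(E) ∘ q^* = q^* ∘ ⌟κ(B)`.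
PRINT-READING PRECISION P-9.3.10: of «all arrows labeled `q^*` are isomorphisms» only the injectivity of this `q^*` is
used. [cite: Markman2025SecantWeil, Remark 9.3.10, p. 88 L13–18] -/
theorem inner_triangle (hmid : ∀ z, t (a z) = kE z) (hsq₁ : ∀ y, a (q₁ y) = q₂ (aB y))
    (hsq₂ : ∀ y, kE (q₁ y) = q₃ (kB y)) (hsq₃ : ∀ w, t (q₂ w) = q₃ (sB w)) (hq₃ : Function.Injective q₃) :
    ∀ y, sB (aB y) = kB y := by
  intro y
  apply hq₃
  rw [← hsq₃, ← hsq₁, hmid, hsq₂]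

/-- REMARK 9.3.10 assembled: «it follows from the commutativity of the outer triangle and the six squares in Diagram
(9.3.5), which implies the commutativity of the intermediate and inner triangles (as all arrows labeled `q^*` are
isomorphisms and the bottom vertical arrow is injective)». [cite: Markman2025SecantWeil, Remark 9.3.10, p. 88 L13–18] -/
theorem remark9310 (houter : ∀ x, sE (ob x) = cE x) (htrap : ∀ z, ob (e z) = i (a z))
    (hleft : ∀ z, cE (e z) = u (kE z)) (hright : ∀ x, sE (i x) = u (t x))
    (hsq₁ : ∀ y, a (q₁ y) = q₂ (aB y)) (hsq₂ : ∀ y, kE (q₁ y) = q₃ (kB y)) (hsq₃ : ∀ w, t (q₂ w) = q₃ (sB w))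
    (hu : Function.Injective u) (hq₃ : Function.Injective q₃) :
    (∀ z, t (a z) = kE z) ∧ ∀ y, sB (aB y) = kB y :=
  have hmid := intermediate_triangle ob e a i kE t u cE sE houter htrap hleft hright hu
  ⟨hmid, inner_triangle a q₁ aB q₂ kB sB q₃ kE t hmid hsq₁ hsq₂ hsq₃ hq₃⟩

/-! ### §C — LEMMA 9.3.11, sentences 3–4: `q^*σ_B` and `σ_B` are injective -/

/-- «The injectivity of the restriction of `q^*σ_B` to `Ext²(E, E)^{G^∨}` follows by the commutativity of the rightmost
square of diagram (9.3.5).» — `σ_E ∘ ⊂ = ∪exp(λ) ∘ q^*σ_B` with `σ_E` (on the invariants) and `⊂` injective forces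
`q^*σ_B` injective (no hypothesis on `∪exp(λ)` is needed). PRINT-READING PRECISION P-9.3.11: the node is
`Ext²₀(E,E)^{G^∨}`. [cite: Markman2025SecantWeil, Lemma 9.3.11, proof p. 88 L23–24] -/
theorem qSigmaB_injective (hright : ∀ x, sE (i x) = u (t x)) (hsE : Function.Injective sE)
    (hi : Function.Injective i) : Function.Injective t := by
  have h : Function.Injective (u ∘ t) := by
    rw [show u ∘ t = sE ∘ i from funext fun x => (hright x).symm]
    exact hsE.comp hi
  exact h.of_comp

/-- «The injectivity of `σ_B` follows by the commutativity of the square with edges `σ_B` and `q^*σ_B`, as the arrows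
labeled `q^*` are all isomorphisms.» — `q^*σ_B ∘ q^* = q^* ∘ σ_B` with `q^*σ_B` and `q^* : H²(Y, 𝒜₀) → Ext²₀(E,E)^{G^∨}`
injective forces `σ_B` injective (only the injectivity of that `q^*` is used).
[cite: Markman2025SecantWeil, Lemma 9.3.11, proof p. 88 L24–27] -/
theorem sigmaB_injective (hsq₃ : ∀ w, t (q₂ w) = q₃ (sB w)) (ht : Function.Injective t)
    (hq₂ : Function.Injective q₂) : Function.Injective sB := by
  have h : Function.Injective (q₃ ∘ sB) := by
    rw [show q₃ ∘ sB = t ∘ q₂ from funext fun w => (hsq₃ w).symm]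
    exact ht.comp hq₂
  exact h.of_comp

/-- LEMMA 9.3.11, sentences 3–4 together: from the injectivity of `σ_E` on `Ext²(E,E)^{G^∨}`, of `⊂` and of
`q^* : H²(Y, 𝒜₀) → Ext²₀(E,E)^{G^∨}`, the rightmost square and the inner right square: `q^*σ_B` AND `σ_B` are injective —
«The twisted reflexive sheaf `B` is semiregular.» (everything named being BY VALUE).
[cite: Markman2025SecantWeil, Lemma 9.3.11, p. 88 L19–27] -/
theorem lemma9311_chase (hright : ∀ x, sE (i x) = u (t x)) (hsq₃ : ∀ w, t (q₂ w) = q₃ (sB w))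
    (hsE : Function.Injective sE) (hi : Function.Injective i) (hq₂ : Function.Injective q₂) :
    Function.Injective t ∧ Function.Injective sB :=
  have ht := qSigmaB_injective i t u sE hright hsE hi
  ⟨ht, sigmaB_injective q₂ sB q₃ t hsq₃ ht hq₂⟩

end Chase

section Assembled

variable {K : Type*} [CommRing K] {T X Ω₀ : Type*} [AddCommGroup T] [Module K T] [AddCommGroup X] [Module K X]
  [AddCommGroup Ω₀] [Module K Ω₀] {X0 A0 ΩY Ω₁ : Type*}

/-- LEMMA 9.3.11, the whole printed proof in one statement: `ob_E : HT²(M) → Ext²(E,E)` with `σ_E ∘ ob_E = ⌟ch(E)`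
(8.3.4), `ker ⌟ch(E) ≤ ker ob_E` (Lemma 8.4.1 (2), Remark 9.2.3), `range ob_E = V := Ext²(E,E)^{G^∨}` (Lemma 9.3.2);
the arrows `⊂ : Ext²₀(E,E)^{G^∨} → V`, `q^*σ_B`, `∪exp(λ)`, `q^* : H²(Y,𝒜₀) → Ext²₀(E,E)^{G^∨}`, `σ_B`,
`q^* : ∏H^{q+2}(Ω^q_Y) → ∏H^{q+2}(Ω^q_M)` with the rightmost and the inner right squares commuting, `⊂` and `q^*`
injective ⟹ `σ_B` is injective. [cite: Markman2025SecantWeil, Lemma 9.3.11, p. 88 L19–27] -/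
theorem lemma9311 (ob : T →ₗ[K] X) (σ : X →ₗ[K] Ω₀) (c : T →ₗ[K] Ω₀) (hcomm : σ ∘ₗ ob = c)
    (hker : LinearMap.ker c ≤ LinearMap.ker ob) (V : Submodule K X) (hV : LinearMap.range ob = V)
    (i : X0 → V) (t : X0 → Ω₁) (u : Ω₁ → Ω₀) (q₂ : A0 → X0) (sB : A0 → ΩY) (q₃ : ΩY → Ω₁)
    (hright : ∀ x, σ (i x) = u (t x)) (hsq₃ : ∀ w, t (q₂ w) = q₃ (sB w))
    (hi : Function.Injective i) (hq₂ : Function.Injective q₂) : Function.Injective sB :=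
  (lemma9311_chase i q₂ sB q₃ t u (σ.domRestrict V) hright hsq₃
    (sigmaE_restrict_injective ob σ c hcomm hker V hV) hi hq₂).2

end Assembled

/-! ### §D — p. 88 L3–9: the leftmost square in the model of `ContractionExpConjugation.lean`, and (9.3.4)'s matrices -/

section LeftmostSquare

open ContractionExp

variable {A : Type*} [CommRing A] [Algebra ℚ A]

/-- «… Lemma 9.3.8 and the equality `ch(E) = exp(λ) ∪ κ(E)` yield the equality
`exp(−λ) ∪ (ζ⌟ch(E)) = (ζ⌟exp(λ))⌟κ(E)`.» — for `ζ ∈ H¹(TM)` (a derivation `D`), `(ζ⌟exp(λ)) = (ζ⌟λ, ζ, 0)` acts on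
`κ` as `(ζ⌟λ) ∪ κ + ζ⌟κ` (Lemma 9.3.8 = `ContractionExp.ad_exp_neg_apply`), and with `ch = exp(l)·κ` the display reads
`exp(−l)·D(exp(l)·κ) = D(l)·κ + D(κ)`. [cite: Markman2025SecantWeil, proof of Lemma 9.3.9, p. 88 L1–4] -/
theorem display_one (D : Derivation ℚ A A) {l : A} (hl : IsNilpotent l) (κ ch : A)
    (hch : ch = IsNilpotent.exp l * κ) : IsNilpotent.exp (-l) * D ch = D l * κ + D κ := by
  rw [hch]
  exact ad_exp_neg_apply D hl κ

/-- «Substitute `ζ⌟exp(−λ)` for `ζ` above and multiply on the left by `exp(λ)` to get the equivalent equality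
`(ζ⌟exp(−λ))⌟ch(E) = exp(λ) ∪ (ζ⌟κ(E))`.» — for `ζ ∈ H¹(TM)`: `(ζ⌟exp(−λ)) = (−ζ⌟λ, ζ, 0)` acts on `ch` as
`−(ζ⌟λ) ∪ ch + ζ⌟ch`, and with `ch = exp(l)·κ`: `−D(l)·ch + D(ch) = exp(l)·D(κ)` (Leibniz and
`D(exp l) = exp(l)·D(l)` = `ContractionExp.apply_exp`). This IS the `H¹(TM)` component of the leftmost square
`⌟ch(E) ∘ ⌟exp(−λ) = ∪exp(λ) ∘ ⌟κ(E)`. [cite: Markman2025SecantWeil, proof of Lemma 9.3.9, p. 88 L5–8] -/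
theorem display_two (D : Derivation ℚ A A) {l : A} (hl : IsNilpotent l) (κ ch : A)
    (hch : ch = IsNilpotent.exp l * κ) : -D l * ch + D ch = IsNilpotent.exp l * D κ := by
  rw [hch, D.leibniz, apply_exp D hl, smul_eq_mul, smul_eq_mul]
  ring

/-- The `H²(𝒪_M)` component of the leftmost square: `ζ ∈ H²(𝒪_M)` is fixed by `⌟exp(−λ)` (column `(1, 0, 0)ᵀ` of
(9.3.4)) and acts by multiplication with a class `z`; `z·ch = exp(l)·(z·κ)` when `ch = exp(l)·κ`.
[cite: Markman2025SecantWeil, proof of Lemma 9.3.9, p. 88 L5–8; (9.3.4) p. 86 L39–69] -/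
theorem display_two_H2O (z : A) {l : A} (κ ch : A) (hch : ch = IsNilpotent.exp l * κ) :
    z * ch = IsNilpotent.exp l * (z * κ) := by
  rw [hch]; ring

/-- «… the bottom vertical arrow is injective» (Remark 9.3.10): in the model, multiplication by `exp(l)` is injective,
`exp(l)` being a unit with inverse `exp(−l)`. [cite: Markman2025SecantWeil, Remark 9.3.10, p. 88 L17–18] -/
theorem mul_exp_injective {l : A} (hl : IsNilpotent l) :
    Function.Injective fun γ : A => IsNilpotent.exp l * γ := by
  intro x y h
  have h' : IsNilpotent.exp (-l) * (IsNilpotent.exp l * x) = IsNilpotent.exp (-l) * (IsNilpotent.exp l * y) := by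
    simp only at h; rw [h]
  rwa [← mul_assoc, ← mul_assoc, IsNilpotent.exp_neg_mul_exp_self hl, one_mul, one_mul] at h'

/-- `(a + b)²/2 = a²/2 + ab + b²/2` with the halves written as `ℚ`-scalars. [folklore] -/
private theorem half_sq_add (a b : A) :
    (2 : ℚ)⁻¹ • ((a + b) * (a + b)) = (2 : ℚ)⁻¹ • (a * a) + a * b + (2 : ℚ)⁻¹ • (b * b) := by
  have : (a + b) * (a + b) = a * a + (2 : ℚ) • (a * b) + b * b := by rw [two_smul]; ring
  rw [this, smul_add, smul_add, smul_smul, inv_mul_cancel₀ (two_ne_zero), one_smul]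

/-- `x/2 + x/2 = x` with the halves written as `ℚ`-scalars. [folklore] -/
private theorem half_add_half (x : A) : (2 : ℚ)⁻¹ • x + (2 : ℚ)⁻¹ • x = x := by
  rw [← add_smul, ← two_mul, mul_inv_cancel₀ (two_ne_zero), one_smul]

/-- The matrix of (9.3.4) «`⌟exp(λ) : H¹(TM) → HT²(M)` … `(1 λ λ²/2 ; 0 1 λ ; 0 0 1)`» (a formal unipotent matrix
with entries in a commutative `ℚ`-algebra): these matrices form a one-parameter group, `U(a)U(b) = U(a + b)` — the only
non-trivial entry being `b²/2 + ab + a²/2 = (a + b)²/2`. [cite: Markman2025SecantWeil, (9.3.4), p. 86 L39–69] -/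
theorem U_mul (a b : A) :
    !![1, a, (2 : ℚ)⁻¹ • (a * a); 0, 1, a; 0, 0, 1] * !![1, b, (2 : ℚ)⁻¹ • (b * b); 0, 1, b; 0, 0, 1] =
      !![1, a + b, (2 : ℚ)⁻¹ • ((a + b) * (a + b)); 0, 1, a + b; 0, 0, (1 : A)] := by
  ext i j
  fin_cases i <;> fin_cases j <;> simp [Matrix.mul_apply, Fin.sum_univ_three, half_sq_add] <;> ring

/-- «Substitute `ζ⌟exp(−λ)` for `ζ` … to get the EQUIVALENT equality»: `⌟exp(−λ)` is the inverse of `⌟exp(λ)` on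
`HT²(M)` — `U(−λ)U(λ) = 1 = U(λ)U(−λ)` for the matrices of (9.3.4) (`(−λ)²/2 = λ²/2`).
[cite: Markman2025SecantWeil, (9.3.4) p. 86 L39–69; proof of Lemma 9.3.9, p. 88 L5] -/
theorem U_neg_mul_self (l : A) :
    !![1, -l, (2 : ℚ)⁻¹ • (l * l); 0, 1, -l; 0, 0, 1] * !![1, l, (2 : ℚ)⁻¹ • (l * l); 0, 1, l; 0, 0, 1] = (1 : _) ∧
    !![1, l, (2 : ℚ)⁻¹ • (l * l); 0, 1, l; 0, 0, 1] * !![1, -l, (2 : ℚ)⁻¹ • (l * l); 0, 1, -l; 0, 0, 1] =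
      (1 : Matrix (Fin 3) (Fin 3) A) := by
  have h : (2 : ℚ)⁻¹ • (l * l) + -(l * l) + (2 : ℚ)⁻¹ • (l * l) = 0 := by
    rw [add_right_comm, half_add_half, add_neg_cancel]
  constructor <;> ext i j <;> fin_cases i <;> fin_cases j <;>
    simp [Matrix.mul_apply, Fin.sum_univ_three, h]

end LeftmostSquare

end Literature.AlgebraicGeometry.Markman2025.Diagram935
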